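import Summits.Ventures.PercRepro.ProfilePointedCircuitClassesMixedPairHolds

/-!
# PercRepro — THE SERIES-PAIR CASE OF `InOutBottomFour`: A POINT OF A 2-COCIRCUIT SATISFIES `in_4(e) ≤ out_5(e)`
(p5, gen 39; `proofs/P5-GM1.md` §56)

`InOutBottomFour` (`in_4(e) ≤ out_5(e)` on `#E = ρ + 4`) was reduced in §54 to points `e` whose deletion `E − e` is
loopless and coloop-free; the case left aside there is the SERIES PAIR: a point `x ≠ e` with `{e, x}` a cocircuit
of `N` (`ρ(E − e) = ρ(E − x) = ρ`, `ρ(E − e − x) = ρ − 1`).  It reduces to the kernel's bottom step `P_3 ≤ P_4` on the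
nullity-`3` matroid `N ∖ {e, x}` (`biIndep_step_three_of_nullity_three`), because neither `e` nor `x` lies in the
closure of any subset of `H′ := E − e − x` (`ρ(H′ + e) = ρ(E − x) = ρ > ρ(H′)`, and likewise for `x`):
* every bi-independent `4`-set `W ∋ e` of `N` avoids `x` (its complement is a basis, and `H′` has rank `ρ − 1`),
  and `W − e` is a bi-independent `3`-set of `N ∖ {e, x}` — so `in_4(e) ≤ P_3(N ∖ {e, x})`;
* every bi-independent `4`-set `U` of `N ∖ {e, x}` gives the bi-independent `5`-set `U + x` of `N` avoiding `e`
  (`ρ(U + x) = ρ(U) + 1`, `E − U − x = (H′ − U) + e` has rank `ρ(H′ − U) + 1`) — so `P_4(N ∖ {e, x}) ≤ out_5(e)`.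
Hence **`inCount_four_le_outCount_five_of_seriesPair`**: `in_4(e) ≤ out_5(e)` for every `ρ ≥ 5`.
-/

open scoped Matroid

namespace PercRepro.Cogirth

open Finset ThmH Skew Shadow Profile

variable {α : Type} [DecidableEq α] {N : Matroid α} [N.Finite]

section SeriesPair

/-- If `y ∉ cl(B)` (witnessed by `ρ(B) < ρ(B + y)`) then `ρ(X + y) = ρ(X) + 1` for every `X ⊆ B`. -/
theorem rk_insert_eq_add_one_of_subset {y : α} (hy : y ∈ gr N) {X B : Finset α} (hXB : X ⊆ B)
    (hB : B ⊆ gr N) (hyB : rk N B < rk N (insert y B)) : rk N (insert y X) = rk N X + 1 := by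
  have hyB' : y ∉ clF N B := by
    intro h
    rw [mem_clF_iff_rk_insert hy hB] at h
    omega
  have hyX : y ∉ clF N X := fun h => hyB' (clF_mono hXB h)
  rw [rk_insert_eq hy (hXB.trans hB), if_neg hyX]

variable {e x : α}

/-- `((E − e) − x) + e = E − x`. -/
theorem insert_erase_erase_eq_erase (he : e ∈ gr N) (hex : e ≠ x) :
    insert e (((gr N).erase e).erase x) = (gr N).erase x := by
  ext a
  simp only [mem_insert, mem_erase]
  constructor
  · rintro (rfl | ⟨hax, _, ha⟩)
    · exact ⟨hex, he⟩
    · exact ⟨hax, ha⟩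
  · rintro ⟨hax, ha⟩
    by_cases hae : a = e
    · exact Or.inl hae
    · exact Or.inr ⟨hax, hae, ha⟩

/-- `((E − e) − x) + x = E − e`. -/
theorem insert_erase_erase_eq_erase' (hx : x ∈ gr N) (hex : e ≠ x) :
    insert x (((gr N).erase e).erase x) = (gr N).erase e := by
  ext a
  simp only [mem_insert, mem_erase]
  constructor
  · rintro (rfl | ⟨_, hae, ha⟩)
    · exact ⟨hex.symm, hx⟩
    · exact ⟨hae, ha⟩
  · rintro ⟨hae, ha⟩
    by_cases hax : a = x
    · exact Or.inl hax
    · exact Or.inr ⟨hax, hae, ha⟩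

/-- **THE SERIES-PAIR CASE OF `InOutBottomFour`**: on `#E = ρ(E) + 4`, `ρ(E) ≥ 5`, if `{e, x}` is a cocircuit
(`ρ(E − e) = ρ(E − x) = ρ(E)`, `ρ(E − e − x) + 1 = ρ(E)`) then `in_4(e) ≤ out_5(e)`. -/
theorem inCount_four_le_outCount_five_of_seriesPair (hn : (gr N).card = rk N (gr N) + 4)
    (hR : 5 ≤ rk N (gr N)) (he : e ∈ gr N) (hx : x ∈ gr N) (hex : e ≠ x)
    (hce : rk N ((gr N).erase e) = rk N (gr N)) (hcx : rk N ((gr N).erase x) = rk N (gr N))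
    (hser : rk N (((gr N).erase e).erase x) + 1 = rk N (gr N)) :
    inCount N 4 e ≤ outCount N 5 e := by
  obtain ⟨H', hH'⟩ : ∃ H', H' = ((gr N).erase e).erase x := ⟨_, rfl⟩
  have hH'E : H' ⊆ gr N := by rw [hH']; exact (erase_subset _ _).trans (erase_subset _ _)
  have heH' : e ∉ H' := by rw [hH']; simp
  have hxH' : x ∉ H' := by rw [hH']; simp
  have hmemH' : ∀ a, a ∈ H' ↔ a ∈ gr N ∧ a ≠ e ∧ a ≠ x := by
    intro a; rw [hH']; simp only [mem_erase]; tauto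
  have hcardH' : H'.card + 2 = (gr N).card := by
    rw [hH', card_erase_of_mem (mem_erase.2 ⟨hex.symm, hx⟩), card_erase_of_mem he]
    have : 1 ≤ ((gr N).erase e).card := card_pos.2 ⟨x, mem_erase.2 ⟨hex.symm, hx⟩⟩
    rw [card_erase_of_mem he] at this
    have := card_pos.2 ⟨e, he⟩
    omega
  rw [← hH'] at hser
  -- `e` and `x` lie in the closure of no subset of `H′`
  have hins_e : ∀ X ⊆ H', rk N (insert e X) = rk N X + 1 := by
    intro X hX
    refine rk_insert_eq_add_one_of_subset he hX hH'E ?_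
    rw [hH', insert_erase_erase_eq_erase he hex, hcx, ← hH']
    omega
  have hins_x : ∀ X ⊆ H', rk N (insert x X) = rk N X + 1 := by
    intro X hX
    refine rk_insert_eq_add_one_of_subset hx hX hH'E ?_
    rw [hH', insert_erase_erase_eq_erase' hx hex, hce, ← hH']
    omega
  -- the deletion `M′ := N ∖ {e} ∖ {x}`
  have hgrM : gr ((N ＼ ({e} : Set α)) ＼ ({x} : Set α)) = H' := by
    rw [gr_delete', gr_delete', hH']
  have hrkM : ∀ X ⊆ H', rk ((N ＼ ({e} : Set α)) ＼ ({x} : Set α)) X = rk N X := by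
    intro X hX
    rw [rk_delete (M := N ＼ ({e} : Set α)) (e := x) (by rw [gr_delete', ← hH']; exact hX),
      rk_delete (M := N) (e := e) (hX.trans (by rw [hH']; exact erase_subset _ _))]
  have hnM : (gr ((N ＼ ({e} : Set α)) ＼ ({x} : Set α))).card =
      rk ((N ＼ ({e} : Set α)) ＼ ({x} : Set α)) (gr ((N ＼ ({e} : Set α)) ＼ ({x} : Set α))) + 3 := by
    rw [hgrM, hrkM H' (Subset.refl _)]
    omega
  have hRM : 4 ≤ rk ((N ＼ ({e} : Set α)) ＼ ({x} : Set α)) (gr ((N ＼ ({e} : Set α)) ＼ ({x} : Set α))) := by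
    rw [hgrM, hrkM H' (Subset.refl _)]
    omega
  have hstep := biIndep_step_three_of_nullity_three hnM hRM
  rw [hgrM] at hstep
  have h34 : (biIndepSets ((N ＼ ({e} : Set α)) ＼ ({x} : Set α)) 3).card ≤
      (biIndepSets ((N ＼ ({e} : Set α)) ＼ ({x} : Set α)) 4).card := by
    have h4 : 4 ≤ H'.card - 3 := by omega
    nlinarith
  -- `in_4(e) ≤ P_3(M′)`: `W ↦ W − e`
  have hin : inCount N 4 e ≤ (biIndepSets ((N ＼ ({e} : Set α)) ＼ ({x} : Set α)) 3).card := by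
    unfold inCount
    apply card_le_card_of_injOn (fun W => W.erase e)
    · intro W hW
      rw [mem_coe, mem_filter, mem_biIndepSets] at hW
      obtain ⟨⟨hWg, hW4, hWrk, hWc⟩, heW⟩ := hW
      -- `x ∉ W`: the complement is a basis, and `H′` has rank `ρ − 1`
      have hxW : x ∉ W := by
        intro hxW
        have hsub : gr N \ W ⊆ H' := by
          intro a ha
          rw [mem_sdiff] at ha
          rw [hmemH']
          exact ⟨ha.1, fun h => ha.2 (h ▸ heW), fun h => ha.2 (h ▸ hxW)⟩
        have h1 := rk_mono' (M := N) hsub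
        have h2 : (gr N \ W).card = (gr N).card - 4 := by rw [card_sdiff_of_subset hWg, hW4]
        omega
      have hUH : W.erase e ⊆ H' := by
        intro a ha
        rw [mem_erase] at ha
        rw [hmemH']
        exact ⟨hWg ha.2, ha.1, fun h => hxW (h ▸ ha.2)⟩
      rw [mem_coe, mem_biIndepSets, hgrM, hrkM _ hUH, hrkM _ sdiff_subset]
      refine ⟨hUH, by rw [card_erase_of_mem heW, hW4], rk_eq_card_of_subset_of_rk_eq_card (erase_subset _ _) hWrk, ?_⟩
      refine rk_eq_card_of_subset_of_rk_eq_card ?_ hWc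
      intro a ha
      rw [mem_sdiff, mem_erase] at ha
      rw [mem_sdiff]
      refine ⟨hH'E ha.1, fun h => ha.2 ⟨?_, h⟩⟩
      rintro rfl
      exact heH' ha.1
    · intro W₁ hW₁ W₂ hW₂ h
      rw [mem_coe, mem_filter] at hW₁ hW₂
      rw [← insert_erase hW₁.2, ← insert_erase hW₂.2]
      exact congrArg (insert e) h
  -- `P_4(M′) ≤ out_5(e)`: `U ↦ U + x`
  have hout : (biIndepSets ((N ＼ ({e} : Set α)) ＼ ({x} : Set α)) 4).card ≤ outCount N 5 e := by
    unfold outCount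
    apply card_le_card_of_injOn (fun U => insert x U)
    · intro U hU
      rw [mem_coe, mem_biIndepSets, hgrM] at hU
      obtain ⟨hUH, hU4, hUrk, hUc⟩ := hU
      rw [hrkM _ hUH] at hUrk
      rw [hrkM _ sdiff_subset] at hUc
      have hxU : x ∉ U := fun h => hxH' (hUH h)
      have heU : e ∉ U := fun h => heH' (hUH h)
      have hcompl : gr N \ insert x U = insert e (H' \ U) := by
        ext a
        simp only [mem_sdiff, mem_insert, hmemH']
        constructor
        · rintro ⟨ha, hax⟩
          by_cases hae : a = e
          · exact Or.inl hae
          · exact Or.inr ⟨⟨ha, hae, fun h => hax (Or.inl h)⟩, fun h => hax (Or.inr h)⟩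
        · rintro (rfl | ⟨⟨ha, _, hax⟩, haU⟩)
          · exact ⟨he, fun h => h.elim (fun h => hex h) heU⟩
          · exact ⟨ha, fun h => h.elim hax haU⟩
      rw [mem_coe, mem_filter, mem_biIndepSets, hcompl, card_insert_of_notMem hxU, hU4,
        card_insert_of_notMem (fun h => heH' (mem_sdiff.1 h).1), hins_x U hUH, hUrk, hU4,
        hins_e (H' \ U) sdiff_subset, hUc]
      refine ⟨⟨insert_subset hx (hUH.trans hH'E), rfl, rfl, rfl⟩, ?_⟩
      rw [mem_insert]
      rintro (h | h)
      · exact hex h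
      · exact heU h
    · intro U₁ hU₁ U₂ hU₂ h
      rw [mem_coe, mem_biIndepSets, hgrM] at hU₁ hU₂
      have h₁ : x ∉ U₁ := fun h' => hxH' (hU₁.1 h')
      have h₂ : x ∉ U₂ := fun h' => hxH' (hU₂.1 h')
      have := congrArg (fun Z => Z.erase x) h
      simpa only [erase_insert h₁, erase_insert h₂] using this
  omega

end SeriesPair

end PercRepro.Cogirth
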